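import Literature.NumberTheory.ComplexMultiplication.CMDefinedOverQbar
import Literature.AlgebraicGeometry.Motives.AbelianVarietyNumberFieldDescent
import Literature.AlgebraicGeometry.Motives.AbelianVarietyBaseChangeTower
import HarnessLib

/-!
# Row II-2 from its `ℚ̄`-form: a CM abelian variety defined over `ℚ̄` is defined over a number field
# (Shimura–Taniyama §12.4 Prop. 26, second half: «an algebraic number field of finite degree»)

Family `hodge` (cell hodgecm-mathlib, INVENTORY §8.2 rows II-2 / II-2β; director ruling 2026-08-28T02:02:06Z;
B-plan1 skeleton `b2-prop26-number-field` v1 4c1590535f4199d9, stub (γ′) `stub_descentToNumberField`), topic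
`Literature/NumberTheory/ComplexMultiplication`.  THEOREMS ONLY (no definition, no named fact).

* `descentToNumberField` — **(γ′) of the skeleton, VERBATIM**: an abelian variety `A₁` over `ℚ̄ = algebraicClosure ℚ ℂ`
  with `ι₁ : 𝓞_K → End A₁` and an `𝓞_K`-equivariant comparison `e₁ : A₁ ⊗ ℂ ≅ A` comes from a number field
  `k` (with its embedding `k → ℂ`): `A₀ ⊗_k ℂ ≅ A`, equivariantly for `ι₀ : 𝓞_K → End A₀`.  PROOF: the CM-free
  descent `AbelianVariety.exists_numberField_descent_ringHom` (EGA IV₃ 8.8.2 over the tree's `Limits` kit, files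
  `Motives/AbelianVarietyFGSubfieldDescentEnd`, `Motives/AbelianVarietyNumberFieldDescent`) gives `(A₀, ι₀)` over a
  number field `k ⊆ ℚ̄` with `A₀ ⊗_k ℚ̄ ≅ A₁`; compose with `e₁` through the transitivity isomorphism
  `(A₀ ⊗_k ℚ̄) ⊗_ℚ̄ ℂ ≅ A₀ ⊗_k ℂ` (`AbelianVariety.baseChangeTowerIso`, natural in homomorphisms).
* `shimura1998_prop26_definedOverNumberField_of_definedOverQbar` — **row II-2 from row II-2β**: the named fact
  `shimura1998_prop26_definedOverQbar` (B-plan1, `CMDefinedOverQbar.lean`) implies the named fact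
  `shimura1998_prop26_definedOverNumberField` (`ShimuraTaniyamaHecke.lean`).  HC_CM is proved only modulo the 7
  printed citations until rung 0 closes; this file moves row II-2's citation to the sharper `ℚ̄`-form, nothing more.

## References
* [Shimura1998] G. Shimura, *Abelian Varieties with Complex Multiplication and Modular Functions* (1998), §12.4
  Prop. 26 (corpus p0125 L9; proof p0125 L12–p0126 L1).
* [EGAIV3] A. Grothendieck, J. Dieudonné, EGA IV₃ (1966), Thm. 8.8.2.
-/

noncomputable section

open CategoryTheory NumberField
open Literature.AlgebraicGeometry.Motives
open Literature.AlgebraicGeometry.HodgeTheory (complexBetti)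
open Literature.AlgebraicGeometry.ComplexMultiplication (IsCMTypeRealisation)

namespace Literature.NumberTheory.ComplexMultiplication

/-- **(γ′) `ℚ̄ →` number field, with the `ℂ`-comparison carried along** (stub `stub_descentToNumberField` of the line
`b2-prop26-number-field`, VERBATIM): an abelian variety `A₁` over `algebraicClosure ℚ ℂ` with an `𝓞_K`-action `ι₁`
and an equivariant `e₁ : A₁ ⊗ ℂ ≅ A` comes from a number field `k → ℂ`: `∃ k, A₀, ι₀, e : A₀ ⊗_k ℂ ≅ A` with
`ι₀(a)_ℂ ≫ e = e ≫ ι(a)`.  EGA IV₃ 8.8.2 (`AbelianVariety.exists_numberField_descent_ringHom`) + transitivity of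
base change (`AbelianVariety.baseChangeTowerIso`). [cite: Shimura1998, §12.4 Prop. 26 (proof, p0125 L12–p0126 L1)]
[cite: EGAIV3, Thm. 8.8.2] -/
theorem descentToNumberField
    (K : Type) [Field K] [NumberField K] (A : AbelianVariety ℂ) (ι : 𝓞 K →+* End A)
    (A₁ : AbelianVariety (algebraicClosure ℚ ℂ)) (ι₁ : 𝓞 K →+* End A₁) (e₁ : A₁.baseChange ℂ ≅ A)
    (he₁ : ∀ a : 𝓞 K, AbelianVariety.Hom.baseChange ℂ (ι₁ a : A₁ ⟶ A₁) ≫ e₁.hom = e₁.hom ≫ (ι a : A ⟶ A)) :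
    ∃ (k : Type) (_ : Field k) (_ : NumberField k) (_ : Algebra k ℂ) (A₀ : AbelianVariety k)
      (ι₀ : 𝓞 K →+* End A₀) (e : A₀.baseChange ℂ ≅ A),
      ∀ a : 𝓞 K, AbelianVariety.Hom.baseChange ℂ (ι₀ a : A₀ ⟶ A₀) ≫ e.hom = e.hom ≫ (ι a : A ⟶ A) := by
  -- `ℚ̄` is algebraic over `ℚ` (for the canonical `ℚ`-algebra structure of a characteristic-zero field, which
  -- is the one `exists_numberField_descent_ringHom` speaks about; `Algebra ℚ _` is a subsingleton)
  haveI : @Algebra.IsAlgebraic ℚ ↥(algebraicClosure ℚ ℂ) _ _ DivisionRing.toRatAlgebra := by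
    have hq : (DivisionRing.toRatAlgebra : Algebra ℚ ↥(algebraicClosure ℚ ℂ)) =
        (algebraicClosure ℚ ℂ).algebra' := Subsingleton.elim _ _
    rw [hq]
    exact algebraicClosure.isAlgebraic ℚ ℂ
  obtain ⟨k, hk, A₀, ι₀, e₀, he₀⟩ :=
    AbelianVariety.exists_numberField_descent_ringHom (↥(algebraicClosure ℚ ℂ)) A₁ ι₁
  -- `k → ℚ̄ → ℂ`
  letI : Algebra (↥k) ℂ :=
    ((algebraMap (↥(algebraicClosure ℚ ℂ)) ℂ).comp (algebraMap (↥k) (↥(algebraicClosure ℚ ℂ)))).toAlgebra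
  haveI hst := IsScalarTower.of_algebraMap_eq (R := ↥k) (S := ↥(algebraicClosure ℚ ℂ)) (A := ℂ)
    (fun _ => rfl)
  -- `(A₀ ⊗_k ℚ̄) ⊗ ℂ ≅ A₁ ⊗ ℂ`
  let M : (A₀.baseChange (↥(algebraicClosure ℚ ℂ))).baseChange ℂ ≅ A₁.baseChange ℂ :=
    (AbelianVariety.baseChangeFunctor (↥(algebraicClosure ℚ ℂ)) ℂ).mapIso e₀
  refine ⟨↥k, inferInstance, hk, inferInstance, A₀, ι₀,
    (AbelianVariety.baseChangeTowerIso (↥k) (↥(algebraicClosure ℚ ℂ)) ℂ A₀).symm ≪≫ M ≪≫ e₁, fun a => ?_⟩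
  have h2 : AbelianVariety.Hom.baseChange ℂ
        (AbelianVariety.Hom.baseChange (↥(algebraicClosure ℚ ℂ)) (ι₀ a : A₀ ⟶ A₀)) ≫
      AbelianVariety.Hom.baseChange ℂ e₀.hom =
      AbelianVariety.Hom.baseChange ℂ e₀.hom ≫ AbelianVariety.Hom.baseChange ℂ (ι₁ a : A₁ ⟶ A₁) := by
    rw [← AbelianVariety.Hom.baseChange_comp, he₀, AbelianVariety.Hom.baseChange_comp]
  rw [Iso.trans_hom, Iso.trans_hom, Iso.symm_hom, Functor.mapIso_hom]
  change AbelianVariety.Hom.baseChange ℂ (ι₀ a : A₀ ⟶ A₀) ≫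
      (AbelianVariety.baseChangeTowerIso (↥k) (↥(algebraicClosure ℚ ℂ)) ℂ A₀).inv ≫
        AbelianVariety.Hom.baseChange ℂ e₀.hom ≫ e₁.hom =
    ((AbelianVariety.baseChangeTowerIso (↥k) (↥(algebraicClosure ℚ ℂ)) ℂ A₀).inv ≫
        AbelianVariety.Hom.baseChange ℂ e₀.hom ≫ e₁.hom) ≫ (ι a : A ⟶ A)
  simp only [Category.assoc]
  rw [← AbelianVariety.baseChangeTowerIso_inv_comp_baseChange_baseChange_assoc, reassoc_of% h2, he₁]

/-- **Row II-2 from row II-2β**: Shimura–Taniyama §12.4 Prop. 26 in the tree's form «model over a NUMBER FIELD»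
(`shimura1998_prop26_definedOverNumberField`) follows from its `ℚ̄`-form (`shimura1998_prop26_definedOverQbar`) by
`descentToNumberField`. [cite: Shimura1998, §12.4 Prop. 26] [cite: EGAIV3, Thm. 8.8.2] -/
theorem shimura1998_prop26_definedOverNumberField_of_definedOverQbar
    (h : shimura1998_prop26_definedOverQbar) : shimura1998_prop26_definedOverNumberField := by
  intro K _ _ _ Φ A ι θ hA
  obtain ⟨A₁, ι₁, e₁, he₁⟩ := h K Φ A ι θ hA
  exact descentToNumberField K A ι A₁ ι₁ e₁ he₁

end Literature.NumberTheory.ComplexMultiplication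

end
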